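import Literature.AlgebraicGeometry.ModuliOfAbelianVarieties.SiegelAdelicMarkingLevelGlue
import Literature.AlgebraicGeometry.AbelianSchemes.AbelianSchemeOverFibreConjugate
import HarnessLib

/-!
# The level clause of Serre rigidity for `conjFibreIso⁻¹ ≫ (CM isogeny)`: the composite fixes the level sections at the twisted point
# ([Milne 2005] §14 «σ(A, s, ηK) = (σA, σs, σηK)» + Thm. 6.11; [Deligne 1971] 4.16)

Topic `AlgebraicGeometry/ModuliOfAbelianVarieties`; namespace `Literature.AlgebraicGeometry.ModuliOfAbelianVarieties.SiegelAdelicMarking`.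
THEOREMS ONLY (no definition, no named fact, no instance, no `sorry`; net Literature debt 0).  Cell `hodgecm-mathlib` (D-0151), FLOOR 0, P6
door (E) of `stub_RGD`, E6 step 8 — **E6-γ brick (G2b-β1)**: the hypothesis `hu` of ★ E6-γ-C `conjugate_comp_eq_comp_of_iso_of_lifts₂`
(★ `SiegelAdmissibleFibreRigidity`) for the pair `e₁ := conjFibreIso` (canonical, ★ `AbelianSchemeOverFibreConjugate`) and `e₂` := the CM isogeny
with its `K_δ(N)`-twisted torsion reading (★ `CMConjugationIsogenyAll`, transported): `(e₁⁻¹ ≫ e₂)` FIXES the level sections `φᵢ(Spec τ ≫ s)`.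
It is ★ W3 (c-iv-glue) `map_restrictPt_level_eq_of_conj_of_hom_eq` (B-p21) at ONE family and the two points `s`, `Spec τ ≫ s`, with the junction
`j := (conjFibreIso τ s)⁻¹`, whose reading of the level sections is ★ `map_conjFibreIso_conjPoints_restrictPt` inverted.
`--supports stmt-HodgeConjecture-24832`, count-neutral; HC_CM is proved only modulo the printed citations until rung 0 closes.

## References
* [Milne2005ShimuraVarieties] J. S. Milne, *Introduction to Shimura varieties* (2005), §6 Thm. 6.11 pp. 74–75, §14 Prop. 14.12 p. 125.
* [Deligne1971TravauxShimura] P. Deligne, *Travaux de Shimura* (1971), 4.16 p. 150.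
* [MumfordFogartyKirwan1994] D. Mumford, J. Fogarty, F. Kirwan, *Geometric Invariant Theory*, 3rd ed. (1994), Ch. 7 §1 Def. 7.1, §3.
-/

set_option autoImplicit false

noncomputable section

open Matrix CategoryTheory AlgebraicGeometry
open Literature.AlgebraicGeometry.Motives (AbelianVariety AlgPoints CartierDivisor)
open Literature.AlgebraicGeometry.AbelianSchemes (AbelianSchemeOver)

namespace Literature.AlgebraicGeometry.ModuliOfAbelianVarieties

namespace SiegelAdelicMarking

variable {g : ℕ} {δ : Fin g → ℕ} {J J' : C0pm δ} {a a' : gspFinAdelic δ}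
variable {N : ℕ} {S : Scheme} {B : AbelianSchemeOver S} {s : Spec (.of ℂ) ⟶ S} {φ : B.LevelStructure g N}
  {τ : ℂ ≃+* ℂ}
  {Θ₁ : CartierDivisor (B.fibre s).toAbelianVariety.X.left}
  {Θ₂ : CartierDivisor (B.fibre (AbelianSchemeOver.specTwist τ ≫ s)).toAbelianVariety.X.left}

/-- **The junction `conjFibreIso⁻¹` reads `(·)^τ` on the level sections** (★ `map_conjFibreIso_conjPoints_restrictPt` inverted):
`e⁻¹(φᵢ(Spec τ ≫ s)) = (φᵢ(s))^τ`. [cite: Milne2005ShimuraVarieties, §14 pp. 124–125] [cite: MumfordFogartyKirwan1994, Ch. 7 §1 Definition 7.1 (p. 129)] -/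
theorem map_conjFibreIso_inv_restrictPt (τ : ℂ ≃+* ℂ) (σ₀ : B.Sections) :
    AlgPoints.map (B.conjFibreIso τ s).inv.hom.hom.hom (B.restrictPt (AbelianSchemeOver.specTwist τ ≫ s) σ₀) =
      (B.fibre s).toAbelianVariety.conjPoints τ (B.restrictPt s σ₀) := by
  rw [← B.map_conjFibreIso_conjPoints_restrictPt τ s σ₀, ← AlgPoints.map_comp_apply]
  have h : (B.conjFibreIso τ s).hom.hom.hom.hom ≫ (B.conjFibreIso τ s).inv.hom.hom.hom =
      ((B.conjFibreIso τ s).hom ≫ (B.conjFibreIso τ s).inv).hom.hom.hom := rfl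
  rw [h, Iso.hom_inv_id]
  simp only [AbelianVariety.id_hom]
  rfl

/-- **(G2b-β1) The composite `conjFibreIso⁻¹ ≫ e₂` fixes the level sections at the twisted point.**  At ONE abelian scheme `B → S` with
level-`N` structure `φ`, a complex point `s` and its twist `Spec τ ≫ s`: markings `m₁` of `B_s` by `[J, a]` and `m₂` of `B_{Spec τ ≫ s}` by `[J′, a′]`
through which the symplectic-lift towers `Λ₁`, `Λ₂` of `φ` read (the tower clauses of ★ `IsAdmissibleAt`); an isomorphism
`e₂ : (B_s)^τ ≅ B_{Spec τ ≫ s}` with the `K_δ(N)`-twisted CM torsion reading «`e₂((m₁.r v)^τ) = m₂.r w` whenever `k a⁻¹ v̂ ≡ a′⁻¹ ŵ`» (★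
`CMConjugationIsogenyAll`, re-indexed).  THEN `((conjFibreIso τ s)⁻¹ ≫ e₂)(φᵢ(Spec τ ≫ s)) = φᵢ(Spec τ ≫ s)` for every `i` — the clause `hu`
of ★ E6-γ-C `conjugate_comp_eq_comp_of_iso_of_lifts₂` with `e₁ := conjFibreIso τ s`.  (★ (c-iv-glue) `map_restrictPt_level_eq_of_conj_of_hom_eq`
with the junction `j := (conjFibreIso τ s)⁻¹`.) [cite: Milne2005ShimuraVarieties, §6 Thm. 6.11 p. 74 and p. 75, §14 Prop. 14.12 p. 125]
[cite: Deligne1971TravauxShimura, 4.16 p. 150] -/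
theorem map_conjFibreIso_symm_trans_restrictPt_eq (hN : N ≠ 0) (τ : ℂ ≃+* ℂ)
    (Λ₁ : φ.SymplecticLift s Θ₁ δ) (m₁ : SiegelAdelicMarking J a (B.fibre s).toAbelianVariety)
    (hΛ₁ : ∀ ⦃M : ℕ⦄, N ∣ M → M ≠ 0 → ∀ (x : Fin g ⊕ Fin g → ZMod M) (v : Fin g ⊕ Fin g → ℚ),
      AdelicCongr ((a⁻¹ : gspFinAdelic δ) : GL (Fin g ⊕ Fin g) finAdeleQ) 1 v (fun i => ((x i).val : ℚ) / M) →
        ((Λ₁.lift M (Multiplicative.ofAdd x)) : (B.fibre s).toAbelianVariety.Points ℂ) = m₁.r v)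
    {Θ₂ : CartierDivisor (B.fibre (AbelianSchemeOver.specTwist τ ≫ s)).toAbelianVariety.X.left}
    (Λ₂ : φ.SymplecticLift (AbelianSchemeOver.specTwist τ ≫ s) Θ₂ δ)
    (m₂ : SiegelAdelicMarking J' a' (B.fibre (AbelianSchemeOver.specTwist τ ≫ s)).toAbelianVariety)
    (hΛ₂ : ∀ ⦃M : ℕ⦄, N ∣ M → M ≠ 0 → ∀ (x : Fin g ⊕ Fin g → ZMod M) (v : Fin g ⊕ Fin g → ℚ),
      AdelicCongr ((a'⁻¹ : gspFinAdelic δ) : GL (Fin g ⊕ Fin g) finAdeleQ) 1 v (fun i => ((x i).val : ℚ) / M) →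
        ((Λ₂.lift M (Multiplicative.ofAdd x)) : (B.fibre (AbelianSchemeOver.specTwist τ ≫ s)).toAbelianVariety.Points ℂ) =
          m₂.r v)
    (e₂ : ((B.fibre s).toAbelianVariety).conjugate τ ≅ (B.fibre (AbelianSchemeOver.specTwist τ ≫ s)).toAbelianVariety)
    (hf : ∃ k ∈ principalLevelSubgroup δ N, ∀ v w : Fin g ⊕ Fin g → ℚ,
      AdelicCongr ((k * a⁻¹ : gspFinAdelic δ) : GL (Fin g ⊕ Fin g) finAdeleQ)
          ((a'⁻¹ : gspFinAdelic δ) : GL (Fin g ⊕ Fin g) finAdeleQ) v w →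
        AlgPoints.map e₂.hom.hom.hom.hom ((B.fibre s).toAbelianVariety.conjPoints τ (m₁.r v)) = m₂.r w)
    (i : Fin g ⊕ Fin g) :
    AlgPoints.map ((B.conjFibreIso τ s).symm ≪≫ e₂).hom.hom.hom.hom
        (B.restrictPt (AbelianSchemeOver.specTwist τ ≫ s) (φ.σ i)) =
      B.restrictPt (AbelianSchemeOver.specTwist τ ≫ s) (φ.σ i) :=
  map_restrictPt_level_eq_of_conj_of_hom_eq hN τ Λ₁ m₁ hΛ₁ Λ₂ m₂ hΛ₂ e₂.hom hf φ (B.conjFibreIso τ s).inv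
    (fun i => map_conjFibreIso_inv_restrictPt τ (φ.σ i)) ((B.conjFibreIso τ s).symm ≪≫ e₂) rfl i

end SiegelAdelicMarking

end Literature.AlgebraicGeometry.ModuliOfAbelianVarieties

end
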